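import Mathlib
import HarnessLib
import Literature.Analysis.FluidPDE.ClassicalSolution

/-!
# Crux `QuarterLogPincer.TypeIQuantSubcubicExp` (stmt-NavierStokesRegularity-24077), line `thin_cascade`:
  frame tools for STUB `stub_cheapCascades` — time truncation of the Tao frame and the
  elementary Type-I / `L³` bookkeeping

Helper file (`--supports stmt-NavierStokesRegularity-24077 --as helper`, lead prover ns-tc-p1) for the
registered stub `stub_cheapCascades` of the skeleton `Cruxes/TypeIQuantSubcubicExp/Lines/thin_cascade.lean`
(v4 `972f24fcf0c3`).  Producing a cheap cascade from a violator of the subcubic-exponential Type-I rate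
needs only RESTRICTION IN TIME of the crux's admissible data (the cascade centre is a datum of
`CheapCascade`, no translation), plus three one-line conversions.  Everything is stated on the UNFOLDED
frame of the crux (`IsClassicalNSSolutionOn (Icc 0 T) 1 0 u p ∧ ∀ n, ∃ C, ∀ t ∈ Icc 0 T, ‖Dⁿu(t)‖₂ ≤ C`),
so this file does not depend on the line's definitions module:

* `frame_restrict` — the Tao frame on `[0,T]` restricts to `[0,t₁]`, `0 < t₁ ≤ T`
  (`IsClassicalNSSolutionOn.mono` on the interval of unique differentiability `Icc 0 t₁` + the `H^k`
  bounds restricted); `classical_restrict_Icc` is the general-viscosity/force version;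
* `typeI_restrict` — the virtual Type-I clause on `[0,T]` with remaining time `τ` IS the virtual
  Type-I clause on `[0,t₁]` with remaining time `T − t₁ + τ`;
* `typeI_remaining_le` — at a point where `‖u‖ = 1/r₀ > 0` the Type-I clause `‖u‖ ≤ M s^{-1/2}`
  forces `0 < M` and `s ≤ M² r₀²`;
* `lintegral_cube_le_of_eLpNorm_three_le` — `‖f‖₃ ≤ A`, `0 ≤ A` ⇒ `∫ ‖f‖³ ≤ A³` (as `lintegral`s of
  `ENNReal.ofReal (‖f x‖ ^ 3)`, the currency of `CheapCascade`);
* `le_mul_rpow_neg_half_of_mul_sqrt_le` — `a √t ≤ F`, `0 < t` ⇒ `a ≤ F · t^{-1/2}` (the shape of the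
  crux's conclusion).

HONEST FRAMING: elementary bookkeeping; no statement about Navier–Stokes regularity is proved here; the
crux, its line and every summit statement remain open.  No summit statement is proved by this file.
-/

noncomputable section

-- the summit-side namespace `Summit.NavierStokesRegularity.NavierStokesRegularity.…` (single-conjunct summit,
-- D-0017) repeats a component by design; the dupNamespace linter would flag every declaration.
set_option linter.dupNamespace false

namespace Summit.NavierStokesRegularity.NavierStokesRegularity.Theorems.ThinCascade

open MeasureTheory Set
open scoped ENNReal
open Literature.Analysis.FluidPDE

/-! ### Restriction in time -/

section Restrict

variable {E : Type*} [NormedAddCommGroup E] [InnerProductSpace ℝ E] [FiniteDimensional ℝ E]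

/-- A classical solution on `[0,T]` is a classical solution on `[0,t₁]` for `0 < t₁ ≤ T`
(`IsClassicalNSSolutionOn.mono`; `Icc 0 t₁` is a set of unique differentiability). [folklore] -/
theorem classical_restrict_Icc {T t₁ ν : ℝ} {f u : ℝ → E → E} {p : ℝ → E → ℝ}
    (h : IsClassicalNSSolutionOn (Icc 0 T) ν f u p) (ht₁ : 0 < t₁) (ht₁T : t₁ ≤ T) :
    IsClassicalNSSolutionOn (Icc 0 t₁) ν f u p :=
  h.mono (Icc_subset_Icc_right ht₁T) (uniqueDiffOn_Icc ht₁)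

end Restrict

/-- TIME TRUNCATION OF THE TAO FRAME: the crux's frame (classical solution on `[0,T]`, `ν = 1`, zero
force, every `H^k` seminorm bounded on `[0,T]`) restricts to the frame on `[0,t₁]`, `0 < t₁ ≤ T`.
[folklore] -/
theorem frame_restrict {T t₁ : ℝ}
    {u : ℝ → EuclideanSpace ℝ (Fin 3) → EuclideanSpace ℝ (Fin 3)} {p : ℝ → EuclideanSpace ℝ (Fin 3) → ℝ}
    (hframe : IsClassicalNSSolutionOn (Icc 0 T) 1 0 u p ∧
      ∀ n : ℕ, ∃ C : NNReal, ∀ t ∈ Icc 0 T, eLpNorm (iteratedFDeriv ℝ n (u t)) 2 volume ≤ C)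
    (ht₁ : 0 < t₁) (ht₁T : t₁ ≤ T) :
    IsClassicalNSSolutionOn (Icc 0 t₁) 1 0 u p ∧
      ∀ n : ℕ, ∃ C : NNReal, ∀ t ∈ Icc 0 t₁, eLpNorm (iteratedFDeriv ℝ n (u t)) 2 volume ≤ C := by
  refine ⟨classical_restrict_Icc hframe.1 ht₁ ht₁T, fun n => ?_⟩
  obtain ⟨C, hC⟩ := hframe.2 n
  exact ⟨C, fun t ht => hC t (Icc_subset_Icc_right ht₁T ht)⟩

/-- A clause quantified over `t ∈ [0,T]` restricts to `t ∈ [0,t₁]`, `t₁ ≤ T` (used for the `L³`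
history bound). [folklore] -/
theorem clause_restrict {α : Type*} {T t₁ : ℝ} {P : ℝ → α → Prop}
    (h : ∀ t ∈ Icc (0 : ℝ) T, ∀ x : α, P t x) (ht₁T : t₁ ≤ T) :
    ∀ t ∈ Icc (0 : ℝ) t₁, ∀ x : α, P t x :=
  fun t ht x => h t (Icc_subset_Icc_right ht₁T ht) x

/-- The virtual Type-I clause `‖u(t,x)‖ ≤ M (T+τ−t)^{-1/2}` on `[0,T]` is the virtual Type-I clause on
`[0,t₁]`, `t₁ ≤ T`, with remaining time `T − t₁ + τ`. [folklore] -/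
theorem typeI_restrict {α : Type*} [Norm α] {T τ t₁ M : ℝ} {u : ℝ → EuclideanSpace ℝ (Fin 3) → α}
    (h : ∀ t ∈ Icc (0 : ℝ) T, ∀ x, ‖u t x‖ ≤ M * (T + τ - t) ^ (-(1 / 2 : ℝ))) (ht₁T : t₁ ≤ T) :
    ∀ t ∈ Icc (0 : ℝ) t₁, ∀ x, ‖u t x‖ ≤ M * (t₁ + (T - t₁ + τ) - t) ^ (-(1 / 2 : ℝ)) := by
  intro t ht x
  have e : t₁ + (T - t₁ + τ) - t = T + τ - t := by ring
  rw [e]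
  exact h t (Icc_subset_Icc_right ht₁T ht) x

/-! ### Elementary conversions -/

/-- At a point where `‖u‖ = a > 0`, the Type-I clause `a ≤ M s^{-1/2}` (`s > 0` the remaining time)
forces `0 < M` and `s ≤ M² (1/a)²`. [folklore] -/
theorem typeI_remaining_le {a s M : ℝ} (ha : 0 < a) (hs : 0 < s)
    (h : a ≤ M * s ^ (-(1 / 2 : ℝ))) : 0 < M ∧ s ≤ M ^ 2 * (1 / a) ^ 2 := by
  have hs' : s ^ (-(1 / 2 : ℝ)) = (Real.sqrt s)⁻¹ := by
    rw [Real.rpow_neg hs.le, Real.sqrt_eq_rpow]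
  rw [hs'] at h
  have hsq : 0 < Real.sqrt s := Real.sqrt_pos.2 hs
  have hM : 0 < M := by
    by_contra hM
    have : M * (Real.sqrt s)⁻¹ ≤ 0 :=
      mul_nonpos_of_nonpos_of_nonneg (not_lt.1 hM) (inv_nonneg.2 hsq.le)
    linarith
  refine ⟨hM, ?_⟩
  -- `a √s ≤ M`, square.
  have h1 : a * Real.sqrt s ≤ M := by
    have := mul_le_mul_of_nonneg_right h hsq.le
    rwa [mul_assoc, inv_mul_cancel₀ hsq.ne', mul_one] at this
  have h2 : (a * Real.sqrt s) ^ 2 ≤ M ^ 2 :=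
    pow_le_pow_left₀ (mul_nonneg ha.le hsq.le) h1 2
  rw [mul_pow, Real.sq_sqrt hs.le] at h2
  rw [one_div, inv_pow]
  rw [← div_eq_mul_inv, le_div_iff₀ (pow_pos ha 2)]
  linarith [h2]

/-- `‖f‖_{L³} ≤ A` with `0 ≤ A` gives `∫ ‖f‖³ ≤ A³`, in the `lintegral`/`ENNReal.ofReal` currency of
`CheapCascade`. [folklore] -/
theorem lintegral_cube_le_of_eLpNorm_three_le {α F : Type*} [MeasurableSpace α] {μ : Measure α}
    [NormedAddCommGroup F] {f : α → F} {A : ℝ}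
    (h : eLpNorm f 3 μ ≤ ENNReal.ofReal A) (hA : 0 ≤ A) :
    ∫⁻ x, ENNReal.ofReal (‖f x‖ ^ 3) ∂μ ≤ ENNReal.ofReal (A ^ 3) := by
  have h3 : eLpNorm f 3 μ = (∫⁻ x, ‖f x‖ₑ ^ (3 : ℝ) ∂μ) ^ (1 / (3 : ℝ)) := by
    rw [eLpNorm_eq_lintegral_rpow_enorm_toReal (by norm_num) (by norm_num)]
    norm_num
  have hint : ∫⁻ x, ENNReal.ofReal (‖f x‖ ^ 3) ∂μ = ∫⁻ x, ‖f x‖ₑ ^ (3 : ℝ) ∂μ := by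
    refine lintegral_congr fun x => ?_
    rw [ENNReal.ofReal_pow (norm_nonneg _), ofReal_norm, ← ENNReal.rpow_natCast]
    norm_num
  rw [hint]
  have := ENNReal.rpow_le_rpow (h3 ▸ h) (by norm_num : (0 : ℝ) ≤ 3)
  rw [← ENNReal.rpow_mul, show (1 / (3 : ℝ)) * 3 = 1 by norm_num, ENNReal.rpow_one] at this
  refine this.trans (le_of_eq ?_)
  rw [ENNReal.ofReal_pow hA, ← ENNReal.rpow_natCast]
  norm_num

/-- `a √t ≤ F` with `0 < t` gives `a ≤ F · t^{-1/2}` (the shape of the crux's conclusion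
`‖u(t,x)‖ ≤ F(A) t^{-1/2}`). [folklore] -/
theorem le_mul_rpow_neg_half_of_mul_sqrt_le {a t F : ℝ} (ht : 0 < t) (h : a * Real.sqrt t ≤ F) :
    a ≤ F * t ^ (-(1 / 2 : ℝ)) := by
  have hsq : 0 < Real.sqrt t := Real.sqrt_pos.2 ht
  rw [Real.rpow_neg ht.le, ← Real.sqrt_eq_rpow, ← div_eq_mul_inv, le_div_iff₀ hsq]
  exact h

end Summit.NavierStokesRegularity.NavierStokesRegularity.Theorems.ThinCascade

end
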